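import Mathlib
import Summits.Ventures.PercRepro.TriangleCapGraph

/-!
# PercRepro — the graphic closed form is sharp at EVERY cyclomatic number (p3, gen 24)

The extremal family: `Kplus k j` = the complete graph on the vertices `0 … k−1` of `Fin (k+1)` plus the vertex `k`
joined to `0 … j−1`. For `2 ≤ k` and `1 ≤ j ≤ k` it is connected, has `C(k,2) + j` edges, cyclomatic number
`ν = C(k−1,2) + j − 1 = tri (k−2) + (j−1)`, and exactly `C(k,3) + C(j,2) = P ν` triangles (`Kplus_sharp`), so the
bound `card_triangles_le_P` is attained; since every `ν` is of this form (`exists_run`), the maximum number of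
triangles of a connected graph with cyclomatic number `ν` is EXACTLY `P_KK(ν)` (`sharp_of_cyclomatic`, together
with `card_triangles_le_P`). Counting goes through `card_cliques_succ` at the vertex `k` and the complete
subgraphs on `0 … k−1` and on `0 … j−1` (`cliques_eq_powersetCard_of_complete`). Axioms: standard.
-/

namespace PercRepro

namespace TriangleCap

namespace Graph

open Finset

section Complete

variable {V : Type*} [DecidableEq V] (G : SimpleGraph V) [DecidableRel G.Adj]

/-- On a vertex set on which `G` is complete, every `m`-subset is a clique. -/
theorem cliques_eq_powersetCard_of_complete {S : Finset V}
    (hS : ∀ a ∈ S, ∀ b ∈ S, a ≠ b → G.Adj a b) (m : ℕ) : cliques G S m = S.powersetCard m := by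
  apply filter_true_of_mem
  intro t ht
  rw [mem_powersetCard] at ht
  intro a ha b hb hab
  exact hS a (ht.1 (by exact_mod_cast ha)) b (ht.1 (by exact_mod_cast hb)) hab

/-- The count on a complete vertex set: `C(#S, m)`. -/
theorem card_cliques_of_complete {S : Finset V}
    (hS : ∀ a ∈ S, ∀ b ∈ S, a ≠ b → G.Adj a b) (m : ℕ) : (cliques G S m).card = S.card.choose m := by
  rw [cliques_eq_powersetCard_of_complete G hS, card_powersetCard]

end Complete

section Family

/-- `K_k` on the vertices `0 … k−1` of `Fin (k+1)` plus the vertex `k` joined to `0 … j−1`. -/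
abbrev Kplus (k j : ℕ) : SimpleGraph (Fin (k + 1)) :=
  SimpleGraph.fromRel (fun a b => (a.val < k ∧ b.val < k) ∨ (a.val = k ∧ b.val < j))

/-- Adjacency in `Kplus k j`. -/
theorem Kplus_adj {k j : ℕ} {a b : Fin (k + 1)} :
    (Kplus k j).Adj a b ↔ a ≠ b ∧ ((a.val < k ∧ b.val < k) ∨ (a.val = k ∧ b.val < j) ∨
      (b.val = k ∧ a.val < j)) := by
  rw [Kplus, SimpleGraph.fromRel_adj]
  constructor
  · rintro ⟨hne, (h | h) | (h | h)⟩
    · exact ⟨hne, Or.inl h⟩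
    · exact ⟨hne, Or.inr (Or.inl h)⟩
    · exact ⟨hne, Or.inl ⟨h.2, h.1⟩⟩
    · exact ⟨hne, Or.inr (Or.inr h)⟩
  · rintro ⟨hne, h | h | h⟩
    · exact ⟨hne, Or.inl (Or.inl h)⟩
    · exact ⟨hne, Or.inl (Or.inr h)⟩
    · exact ⟨hne, Or.inr (Or.inr h)⟩

/-- A vertex of `Fin (k+1)` other than the last one has value `< k`. -/
theorem val_lt_of_ne_last {k : ℕ} {w : Fin (k + 1)} (h : w ≠ Fin.last k) : w.val < k := by
  have h1 := w.isLt
  have h2 : w.val ≠ k := fun hv => h (Fin.ext (by rw [hv, Fin.val_last]))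
  omega

/-- The neighbours of the last vertex in `Kplus k j` (for `j ≤ k`) are the vertices with value `< j`. -/
theorem nbrs_Kplus_last {k j : ℕ} (hjk : j ≤ k) :
    nbrs (Kplus k j) univ (Fin.last k) = univ.filter (fun w : Fin (k + 1) => w.val < j) := by
  ext w
  rw [mem_nbrs, mem_filter, Kplus_adj, Fin.val_last]
  constructor
  · rintro ⟨-, hne, -, h | h | h⟩
    · omega
    · exact ⟨mem_univ _, h.2⟩
    · exfalso
      exact hne (Fin.ext (by rw [Fin.val_last]; exact h.1))
  · rintro ⟨-, hw⟩
    have hne : w ≠ Fin.last k := by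
      intro h; rw [h, Fin.val_last] at hw; omega
    exact ⟨mem_univ _, hne, Ne.symm hne, Or.inr (Or.inl ⟨rfl, hw⟩)⟩

/-- The vertices other than the last one form a complete subgraph. -/
theorem Kplus_complete_erase {k j : ℕ} :
    ∀ a ∈ (univ : Finset (Fin (k + 1))).erase (Fin.last k),
      ∀ b ∈ (univ : Finset (Fin (k + 1))).erase (Fin.last k), a ≠ b → (Kplus k j).Adj a b := by
  intro a ha b hb hab
  rw [mem_erase] at ha hb
  exact Kplus_adj.2 ⟨hab, Or.inl ⟨val_lt_of_ne_last ha.1, val_lt_of_ne_last hb.1⟩⟩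

/-- The neighbours of the last vertex form a complete subgraph (for `j ≤ k`). -/
theorem Kplus_complete_nbrs {k j : ℕ} (hjk : j ≤ k) :
    ∀ a ∈ nbrs (Kplus k j) univ (Fin.last k), ∀ b ∈ nbrs (Kplus k j) univ (Fin.last k),
      a ≠ b → (Kplus k j).Adj a b := by
  intro a ha b hb hab
  rw [nbrs_Kplus_last hjk, mem_filter] at ha hb
  exact Kplus_adj.2 ⟨hab, Or.inl ⟨by omega, by omega⟩⟩

/-- `Kplus k j` has `C(k,3) + C(j,2)` triangles (for `j ≤ k`). -/
theorem card_triangles_Kplus {k j : ℕ} (hjk : j ≤ k) :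
    ((Kplus k j).cliqueFinset 3).card = k.choose 3 + j.choose 2 := by
  rw [← cliques_univ_eq_cliqueFinset, card_cliques_succ (Kplus k j) (mem_univ (Fin.last k)) 2,
    card_cliques_of_complete _ Kplus_complete_erase, card_cliques_of_complete _ (Kplus_complete_nbrs hjk),
    card_erase_of_mem (mem_univ _), card_univ, Fintype.card_fin, nbrs_Kplus_last hjk,
    Fin.card_filter_val_lt, Nat.add_sub_cancel, min_eq_right (by omega)]

/-- `Kplus k j` has `C(k,2) + j` edges (for `j ≤ k`). -/
theorem card_edges_Kplus {k j : ℕ} (hjk : j ≤ k) :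
    (Kplus k j).edgeFinset.card = k.choose 2 + j := by
  rw [card_edgeFinset_eq_card_cliques_two, card_cliques_succ (Kplus k j) (mem_univ (Fin.last k)) 1,
    card_cliques_of_complete _ Kplus_complete_erase, card_cliques_one,
    card_erase_of_mem (mem_univ _), card_univ, Fintype.card_fin, nbrs_Kplus_last hjk,
    Fin.card_filter_val_lt, Nat.add_sub_cancel, min_eq_right (by omega)]

/-- `Kplus k j` is connected for `1 ≤ j` (and `1 ≤ k`). -/
theorem Kplus_connected {k j : ℕ} (hk : 1 ≤ k) (hj : 1 ≤ j) : (Kplus k j).Connected := by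
  rw [SimpleGraph.connected_iff_exists_forall_reachable]
  refine ⟨⟨0, by omega⟩, fun w => ?_⟩
  by_cases h0 : w = ⟨0, by omega⟩
  · rw [h0]
  by_cases hl : w = Fin.last k
  · rw [hl]
    refine SimpleGraph.Adj.reachable (Kplus_adj.2 ⟨?_, Or.inr (Or.inr ⟨Fin.val_last k, ?_⟩)⟩)
    · intro h
      have := congrArg Fin.val h
      rw [Fin.val_last] at this
      simp at this
      omega
    · show (0 : ℕ) < j
      omega
  · refine SimpleGraph.Adj.reachable (Kplus_adj.2 ⟨Ne.symm h0, Or.inl ⟨?_, val_lt_of_ne_last hl⟩⟩)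
    show (0 : ℕ) < k
    omega

/-- **SHARPNESS AT EVERY PARAMETER:** for `2 ≤ k` and `1 ≤ j ≤ k`, `Kplus k j` attains the bound of
`card_triangles_le_P`: its triangle count equals `P` of its cyclomatic number `C(k,2) + j + 1 − (k+1)`. -/
theorem Kplus_sharp {k j : ℕ} (hk : 2 ≤ k) (hj : 1 ≤ j) (hjk : j ≤ k) :
    ((Kplus k j).cliqueFinset 3).card =
      KK.P ((Kplus k j).edgeFinset.card + 1 - Fintype.card (Fin (k + 1))) := by
  rw [card_triangles_Kplus hjk, card_edges_Kplus hjk, Fintype.card_fin]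
  obtain ⟨m, rfl⟩ : ∃ m, k = m + 2 := ⟨k - 2, by omega⟩
  have e1 : (m + 2).choose 2 + j + 1 - (m + 2 + 1) = KK.tri m + (j - 1) := by
    have : (m + 2).choose 2 = (m + 1) + (m + 1).choose 2 := by
      have := Nat.choose_succ_succ (m + 1) 1
      simpa [Nat.choose_one_right] using this
    rw [this, ← KK.tri_eq_choose]
    omega
  rw [e1, KK.P_closed m (j - 1) (by omega), Nat.sub_add_cancel hj]

/-- Every `ν` is the cyclomatic number of some `Kplus k j` with `2 ≤ k`, `1 ≤ j ≤ k`. -/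
theorem exists_Kplus_param (ν : ℕ) : ∃ k j, 2 ≤ k ∧ 1 ≤ j ∧ j ≤ k ∧ ν = KK.tri (k - 2) + (j - 1) := by
  rcases Nat.eq_zero_or_pos ν with rfl | hν
  · exact ⟨2, 1, le_rfl, le_rfl, by norm_num, by simp [KK.tri_zero]⟩
  · obtain ⟨t, i, hi1, hi, rfl⟩ := KK.exists_run ν hν
    exact ⟨t + 2, i + 1, by omega, by omega, by omega, by simp⟩

/-- **THE BOUND IS SHARP AT EVERY CYCLOMATIC NUMBER:** for every `ν` there is a finite connected simple graph with
cyclomatic number `ν` and exactly `P_KK(ν)` triangles. With `card_triangles_le_P` this says that the maximum number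
of triangles of a connected graph with cyclomatic number `ν` is exactly `P_KK(ν)`. -/
theorem sharp_of_cyclomatic (ν : ℕ) :
    ∃ (n : ℕ) (G : SimpleGraph (Fin (n + 1))) (_ : DecidableRel G.Adj),
      G.Connected ∧ G.edgeFinset.card + 1 = (n + 1) + ν ∧ (G.cliqueFinset 3).card = KK.P ν := by
  obtain ⟨k, j, hk, hj, hjk, rfl⟩ := exists_Kplus_param ν
  refine ⟨k, Kplus k j, inferInstance, Kplus_connected (by omega) hj, ?_, ?_⟩
  · rw [card_edges_Kplus hjk]
    obtain ⟨m, rfl⟩ : ∃ m, k = m + 2 := ⟨k - 2, by omega⟩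
    have : (m + 2).choose 2 = (m + 1) + (m + 1).choose 2 := by
      have := Nat.choose_succ_succ (m + 1) 1
      simpa [Nat.choose_one_right] using this
    rw [this, ← KK.tri_eq_choose, Nat.add_sub_cancel]
    omega
  · rw [card_triangles_Kplus hjk]
    obtain ⟨m, rfl⟩ : ∃ m, k = m + 2 := ⟨k - 2, by omega⟩
    rw [Nat.add_sub_cancel, KK.P_closed m (j - 1) (by omega), Nat.sub_add_cancel hj]

end Family

end Graph

end TriangleCap

end PercRepro
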